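import Summits.CriticalPhenomena.PercolationContinuityZ3.Theorems.PercNearOneGluingNoHeavyPcintMemUniformTenStruct
import Summits.CriticalPhenomena.PercolationContinuityZ3.Theorems.PercNearOneGluingNoHeavyPcintMemUniformTenWeightsC
import Summits.CriticalPhenomena.PercolationContinuityZ3.Theorems.PercNearOneGluingNoHeavyPcintMemUniformChunkCert
import HarnessLib

/-!
# CriticalPhenomena/PercolationContinuityZ3 — Theorems/PercNearOneGluingNoHeavyPcintMemUniformTenPolyA.lean: the K = 9 polynomial certificate of the memory-10 list, rows 0–1547 (kernel)

Lane prim-pcint, STRUCTURE rule (prim-pcint-2 GEN 19).  `UPolyRowsC perm6 u10tab w10tab num10Hi num10Lo 9 5 lo 516 = true` for three 516-row ranges, each by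
`decide +kernel` (≈ 110 s each; the gate's elaboration limit is 600 s per file, so the twelve ranges are spread over …TenPolyA–D and assembled in
…MemUniformTen).  Generated by numerics/emit_u10cert.py.

HONEST FRAMING: kernel evaluation of a finite check.  No `sorry`; standard axioms.  Written by prim-pcint-2 gen 19, 2026-08-26.
-/

noncomputable section

namespace Summit.CriticalPhenomena.PercolationContinuityZ3.Theorems.Pcint

open Literature.Probability.Percolation Literature.Probability.LatticeModels PolyCert

/-- Polynomial certificate, rows 0–515. [folklore] -/
theorem poly10_0 : UPolyRowsC perm6 u10tab w10tab num10Hi num10Lo 9 5 0 516 = true := by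
  decide +kernel

/-- Polynomial certificate, rows 516–1031. [folklore] -/
theorem poly10_516 : UPolyRowsC perm6 u10tab w10tab num10Hi num10Lo 9 5 516 516 = true := by
  decide +kernel

/-- Polynomial certificate, rows 1032–1547. [folklore] -/
theorem poly10_1032 : UPolyRowsC perm6 u10tab w10tab num10Hi num10Lo 9 5 1032 516 = true := by
  decide +kernel

end Summit.CriticalPhenomena.PercolationContinuityZ3.Theorems.Pcint
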